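import Summits.Langlands.Langlands.Theorems.QuadraticWindowHostInducedRepOneTransparentPane
import Summits.Langlands.Langlands.Theorems.QuadraticWindowHostInducedRepRankOne
import Literature.NumberTheory.GaloisRepresentations.ArtinCharacterReciprocityArchimedeanProofs
import Literature.NumberTheory.Automorphic.BaseChangeCyclicCuspidalUnramified
import Literature.NumberTheory.Automorphic.WeaklyRegularGaloisRepCont
import Literature.NumberTheory.Automorphic.AsaiSignCont
import Summits.Langlands.Langlands.Theorems.QuadraticWindowHostInducedRepPackageComposeInf1
import Summits.Langlands.Langlands.Theorems.QuadraticWindowHostInducedRepInfinityTypeGLOne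
import HarnessLib

/-!
# `QuadraticWindow.HostInducedRep` — the closure of the crux, conditional on its published inputs

Crux `Summit.Langlands.Langlands.Theses.QuadraticWindow.HostInducedRep` (item stmt-Langlands-10902, route
`QuadraticWindow`), line `one-transparent-pane` (three leads, 2026-08-16).  Every STRUCTURAL step of the
line is a landed theorem of the tree (`Theorems/QuadraticWindowHostInducedRep*.lean`, 40 files); what the
crux still consumes from print is a list of NAMED FACTS of `Literature/` (unproved published theorems,
D-0014).  This file states the closure honestly:

* `HostInducedRep_proof` — the crux from TWELVE named facts (hypotheses, by name):
  lang.S27 `exists_galoisRep_of_regularAlgebraic` (Harris–Lan–Taylor–Thorne Thm. A + Varma);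
  `FakhruddinPilloni2021_galoisRep_of_weaklyRegular_oddCont` (F–P 2021 Thm. 9.10, continuation-form
  oddness); `JacquetShalika1981_isEssConjSelfDual_of_isConjSelfDualAE` (J–S 1981 II Thm. 4.4, pairing
  form); `automorphicInduction_cyclic_cuspidal_unramified` (Arthur–Clozel Ch. 3 Thm. 6.2 + Henniart 2012;
  = route crux `AutomorphicInductionUnramified`, stmt-Langlands-15138);
  `ArthurClozel1989_cuspidalBaseChange_unramified` (Arthur–Clozel Ch. 3 Thm. 4.2 (a) + 5.1, filed by this
  lead); the Hecke-character extension along a quadratic `K/F₀` (Hewitt–Ross (24.12), inline);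
  `ArthurClozel1989_strongLifting_archimedean`; `Henniart2012_infinityType_of_automorphicInduction`;
  existence of infinity types (Clozel 1990 §3.3, inline); `Mok2014_archimedean_parity_of_asaiSignCont`
  (Mok 2014 Thm. 2.4.10 + Cor. 2.5.5, coset form); `Mok2014_partialAsaiL_continuation_pole_dichotomy`
  (Mok 2014 Thm. 2.5.4 (a)); `GrbacShahidi2015_partialAsaiL_at_one` (Grbac–Shahidi 2015 Thm. 4.3).
  The thirteenth input of the first lead's closure `HostInducedRep_of_publishedFactsCont` (p119829),
  `artinReciprocity_character_archimedean`, is DISCHARGED in the tree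
  (`artinReciprocity_character_archimedean_holds`, `ArtinCharacterReciprocityArchimedeanProofs`) and is
  fed unconditionally here.
* The dependency matrix is made visible by the proof term: ranks `n ≤ 1` use NO fact
  (`Slices.hostInducedRep_of_forall_two_le`: `hostInducedRepAt_zero`, `hostInducedRepAt_one`,
  `QuadraticWindowHostInducedRepRankOne.lean`); for `F` totally real OR CM only lang.S27 is used
  (`inducedPackage_of_S27`, this file); the remaining case — `F` of mixed signature, `n ≥ 2`, the
  route's NEW case — uses the twelve.

Nothing here is unconditional beyond what is said: the item closes only when the twelve facts are
discharged or promoted (planner's bookkeeping: two of them already are route cruxes' bodies).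
-/

set_option linter.dupNamespace false -- the summit-side namespace `Summit.Langlands.Langlands.…` repeats `Langlands` by design (D-0017 single-conjunct summit)

noncomputable section

open Polynomial
open scoped NumberField Classical -- `Classical`: the place subtypes indexing `mixedSpace K` are `Fintype` classically (`NormedCommRing (mixedSpace K)` in `AutomorphyDatum.gl`)
open IsDedekindDomain Field NumberField Filter
open Literature.NumberTheory.GaloisRepresentations Literature.NumberTheory.Automorphic
open Summit.Langlands.Langlands.Theses.QuadraticWindow
open Summit.Langlands.Langlands.Theorems.HostInducedRep.OneTransparentPane
open Summit.Langlands.Langlands.Theorems.HostInducedRep.Slices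

namespace Summit.Langlands.Langlands.Theorems

/-- **The totally-real-or-CM stratum of the crux needs only lang.S27.**  For `F` quadratic over `F₀`
which is totally real OR CM (the two cases covered by `exists_galoisRep_of_regularAlgebraic`), every
cuspidal regular algebraic `π` on `GL_n(𝔸_F)` and every rank-one Artin avatar `eψ`: a semisimple
`R : Γ_{F₀} → GL_{2n}(ℚ̄_ℓ)` unramified with the host polynomial `∏_{w∣v} P_w(X^{f(w∣v)})`,
`P_w = arithFrobPolyOfSatake ι q_w n (α_w · c_w)`, at every good place `v`.  Proof: `ρ := r_{ℓ,ι}(π)`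
(lang.S27), `ρ' := ρ ⊗ ẽψ` (`exists_twist_package`), `R :=` the semisimplified `Ind ρ'`
(`hasQuadraticInduction`); verbatim the landed `stub_totallyRealInduction_cond` with the field-class
hypothesis widened from `IsTotallyReal F` to `IsTotallyReal F ∨ IsCMField F`.
[cite: HarrisLanTaylorThorneRMS2016, Thm. A] -/
theorem inducedPackage_of_S27 (hS27 : exists_galoisRep_of_regularAlgebraic)
    (F₀ F : Type) [Field F₀] [NumberField F₀] [Field F] [NumberField F] [Algebra F₀ F]
    (n : ℕ) (hcpt : isCompact_glFiniteIntegralLevel n F) (π : CuspidalAutomorphicRepData n F hcpt)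
    (ℓ : ℕ) [Fact ℓ.Prime] (ι : PadicAlgCl ℓ ≃+* ℂ) (eψ : FramedGaloisRep F ℂ 1)
    (hF : IsTotallyReal F ∨ IsCMField F) (hdeg : Module.finrank F₀ F = 2) (hreg : π.1.IsRegularAlgebraic) :
    ∃ R : FramedGaloisRep F₀ (PadicAlgCl ℓ) (2 * n), R.toGaloisRep.IsSemisimple ∧
      ∀ (v : HeightOneSpectrum (𝓞 F₀)) (α : HeightOneSpectrum (𝓞 F) → Multiset ℂ)
          (c : HeightOneSpectrum (𝓞 F) → ℂ), ((ℓ : ℕ) : 𝓞 F₀) ∉ v.asIdeal →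
        (∀ w : HeightOneSpectrum (𝓞 F), w.under (𝓞 F₀) = v → w.asIdeal.ramificationIdx (𝓞 F₀) = 1 ∧
            π.1.HasSatakeParamAt w (α w) ∧ eψ.IsUnramifiedAt w ∧
            eψ.HasFrobCharpolyAt w (Polynomial.X - Polynomial.C (c w))) →
        R.IsUnramifiedAt v ∧ R.HasFrobCharpolyAt v
          (∏ᶠ w ∈ {w : HeightOneSpectrum (𝓞 F) | w.under (𝓞 F₀) = v},
              Polynomial.expand (PadicAlgCl ℓ) (w.asIdeal.inertiaDeg (𝓞 F₀))
                (arithFrobPolyOfSatake ι w.residueCard n ((α w).map (fun a ↦ a * c w)))) := by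
  obtain ⟨ρ, -, hρ⟩ := hS27 hcpt hF π hreg ℓ ι
  obtain ⟨ρ', hρ'⟩ := exists_twist_package ι π eψ ρ hρ
  haveI : Algebra.IsQuadraticExtension F₀ F := ⟨hdeg⟩
  obtain ⟨R, hRss, hR⟩ := exists_semisimple_induce_package hdeg ρ'
  refine ⟨R, hRss, fun v α c hv hguard ↦
    hR v (fun w ↦ arithFrobPolyOfSatake ι w.residueCard n ((α w).map (fun a ↦ a * c w)))
      fun w hw ↦ ?_⟩
  obtain ⟨he, hsat, hψu, hψc⟩ := hguard w hw
  refine ⟨he, hρ' w (α w) (c w) ?_ hsat hψu hψc⟩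
  -- `ℓ ∉ w` because `ℓ ∉ v = w ∩ 𝓞 F₀`
  have hmem : ((ℓ : ℕ) : 𝓞 F) ∈ w.asIdeal ↔ ((ℓ : ℕ) : 𝓞 F₀) ∈ (w.under (𝓞 F₀)).asIdeal := by
    rw [HeightOneSpectrum.under_asIdeal, Ideal.under_def, Ideal.mem_comap, map_natCast]
  rw [hmem, hw]
  exact hv

/-- **`HostInducedRep_proof` — the crux `QuadraticWindow.HostInducedRep`, conditional on TWELVE
published named facts of `Literature/`** (see the module docstring for the list with citations; the
thirteenth input of the first lead's closure, `artinReciprocity_character_archimedean`, is a theorem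
of the tree and is supplied here).  The proof term displays the dependency matrix: ranks `n ≤ 1` —
no fact (`hostInducedRep_of_forall_two_le`); `F` totally real or CM — `hS27` only
(`inducedPackage_of_S27`); `F` of mixed signature, `n ≥ 2` — the landed line
`HostInducedRep_of_publishedFactsCont` (biquadratic pane: AI + BC + laundering over the CM
quadratic family `F₀(√-D)`, Mok's dichotomy + sign pin + Grbac–Shahidi for the Asai-pole transfer,
Fakhruddin–Pilloni + Jacquet–Shalika for the Galois representations over `K_D`, Sorensen patching).
This theorem does NOT settle the item unconditionally: its trust base is exactly the twelve names.
[cite: FakhruddinPilloni2021, Thm. 9.10] [cite: Mok2014, Thm. 2.5.4 (a) and Cor. 2.5.5]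
[cite: ArthurClozelAMS120, Ch. 3 Thm. 4.2, 5.1, 6.2] [cite: HarrisLanTaylorThorneRMS2016, Thm. A] -/
theorem HostInducedRep_proof
    (hS27 : exists_galoisRep_of_regularAlgebraic)
    (hFP : FakhruddinPilloni2021_galoisRep_of_weaklyRegular_oddCont)
    (hSMO : JacquetShalika1981_isEssConjSelfDual_of_isConjSelfDualAE)
    (hAI : automorphicInduction_cyclic_cuspidal_unramified)
    (hBC : ArthurClozel1989_cuspidalBaseChange_unramified)
    (hExt : ∀ (F₀ K : Type) [Field F₀] [NumberField F₀] [Field K] [NumberField K] [Algebra F₀ K]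
        (c : K ≃ₐ[F₀] K), Module.finrank F₀ K = 2 → c ≠ 1 →
        ∀ (χ₀ : HeckeCharacter F₀), χ₀.IsUnitary →
        ∀ (U : Set (HeightOneSpectrum (𝓞 K))),
          (∀ u ∈ U, c • u ∈ U → χ₀.IsUnramifiedAt (u.under (𝓞 F₀))) →
          ∃ χ : HeckeCharacter K, χ.IsUnitary ∧
            (∀ x, χ (AdeleRing.ideleBaseChange F₀ K x) = χ₀ x) ∧ ∀ u ∈ U, χ.IsUnramifiedAt u)
    (hArchBC : ArthurClozel1989_strongLifting_archimedean)
    (hHen : Henniart2012_infinityType_of_automorphicInduction)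
    (hInf : ∀ (N : ℕ) (K : Type) [Field K] [NumberField K] (hK : isCompact_glFiniteIntegralLevel N K)
        (P : AutomorphicRepData (AutomorphyDatum.gl N K hK)), P.exists_hasInfinityType)
    (hPin : Mok2014_archimedean_parity_of_asaiSignCont)
    (hMok : Mok2014_partialAsaiL_continuation_pole_dichotomy)
    (hGS : GrbacShahidi2015_partialAsaiL_at_one) :
    Summit.Langlands.Langlands.Theses.QuadraticWindow.HostInducedRep := by
  refine hostInducedRep_of_forall_two_le fun n _hn ↦ ?_
  intro F₀ F _ _ _ _ _ τ hTR hdeg hτ hcpt π e k hreg hpol hpar hodd ℓ _ ι hℓ hunr eψ hψunr hψpar hψnti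
  by_cases hF : IsTotallyReal F ∨ IsCMField F
  · exact inducedPackage_of_S27 hS27 F₀ F n hcpt π ℓ ι eψ hF hdeg hreg
  · exact HostInducedRep_of_publishedFactsCont hS27 hFP hSMO hAI hBC hExt hArchBC hHen hInf
      artinReciprocity_character_archimedean_holds hPin hMok hGS F₀ F τ hTR hdeg hτ n hcpt π e k hreg
      hpol hpar hodd ℓ ι hℓ hunr eψ hψunr hψpar hψnti

end Summit.Langlands.Langlands.Theorems

/-! ## v6 (third lead, continuation c1, 2026-08-16): the closure from ELEVEN named facts

Two inputs of `HostInducedRep_proof` are removed by theorems of the tree landed after it: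
* `hInf` (existence of infinity types for every `GL_N` over every number field) — the line applies it
  only over the totally real `F₀` (fact-free: `exists_hasArchParameter_gl` +
  `exists_hasInfinityType_of_isTotallyReal`, inside `stub_memberArch_inf1`, p121379) and in RANK ONE over
  the CM field `K`, which is the theorem `exists_hasInfinityType_gl_one`
  (`QuadraticWindowHostInducedRepInfinityTypeGLOne.lean`, p121548: torus integrality of the archimedean
  parameter of a `GL₁` datum);
* `hCFT` was already supplied in `HostInducedRep_proof`; here it no longer even transits through the
  laundering (`pkg_member_of_split_inf1` / `stub_package_inf1`, …PackageComposeInf1.lean).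
-/

namespace Summit.Langlands.Langlands.Theorems

open Literature.NumberTheory.GaloisRepresentations.QuadraticFamily
open Summit.Langlands.Langlands.Theorems.HostInducedRep.GrsExplicitDescent

/-- **`HostInducedRep_proof_eleven` — the crux `QuadraticWindow.HostInducedRep` from ELEVEN published
named facts**: lang.S27 `exists_galoisRep_of_regularAlgebraic`;
`FakhruddinPilloni2021_galoisRep_of_weaklyRegular_oddCont`;
`JacquetShalika1981_isEssConjSelfDual_of_isConjSelfDualAE`; `automorphicInduction_cyclic_cuspidal_unramified`
(= route crux stmt-Langlands-15138); `ArthurClozel1989_cuspidalBaseChange_unramified`; the Hecke-character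
extension along a quadratic `K/F₀` (Hewitt–Ross (24.12), inline `hExt`);
`ArthurClozel1989_strongLifting_archimedean`; `Henniart2012_infinityType_of_automorphicInduction`;
`Mok2014_archimedean_parity_of_asaiSignCont`; `Mok2014_partialAsaiL_continuation_pole_dichotomy`;
`GrbacShahidi2015_partialAsaiL_at_one`.  Dependency matrix as in `HostInducedRep_proof`: ranks `n ≤ 1`
no fact; `F` totally real or CM: `hS27` only; mixed `F`, `n ≥ 2`: the eleven, composed exactly as the
first lead's `HostInducedRep_of_publishedFactsCont` but through `stub_package_inf1`.  CONDITIONAL: the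
trust base is the eleven names. [cite: FakhruddinPilloni2021, Thm. 9.10]
[cite: Mok2014, Thm. 2.5.4 (a) and Cor. 2.5.5] [cite: ArthurClozelAMS120, Ch. 3 Thm. 4.2, 5.1, 6.2]
[cite: HarrisLanTaylorThorneRMS2016, Thm. A] -/
theorem HostInducedRep_proof_eleven
    (hS27 : exists_galoisRep_of_regularAlgebraic)
    (hFP : FakhruddinPilloni2021_galoisRep_of_weaklyRegular_oddCont)
    (hSMO : JacquetShalika1981_isEssConjSelfDual_of_isConjSelfDualAE)
    (hAI : automorphicInduction_cyclic_cuspidal_unramified)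
    (hBC : ArthurClozel1989_cuspidalBaseChange_unramified)
    (hExt : ∀ (F₀ K : Type) [Field F₀] [NumberField F₀] [Field K] [NumberField K] [Algebra F₀ K]
        (c : K ≃ₐ[F₀] K), Module.finrank F₀ K = 2 → c ≠ 1 →
        ∀ (χ₀ : HeckeCharacter F₀), χ₀.IsUnitary →
        ∀ (U : Set (HeightOneSpectrum (𝓞 K))),
          (∀ u ∈ U, c • u ∈ U → χ₀.IsUnramifiedAt (u.under (𝓞 F₀))) →
          ∃ χ : HeckeCharacter K, χ.IsUnitary ∧
            (∀ x, χ (AdeleRing.ideleBaseChange F₀ K x) = χ₀ x) ∧ ∀ u ∈ U, χ.IsUnramifiedAt u)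
    (hArchBC : ArthurClozel1989_strongLifting_archimedean)
    (hHen : Henniart2012_infinityType_of_automorphicInduction)
    (hPin : Mok2014_archimedean_parity_of_asaiSignCont)
    (hMok : Mok2014_partialAsaiL_continuation_pole_dichotomy)
    (hGS : GrbacShahidi2015_partialAsaiL_at_one) :
    Summit.Langlands.Langlands.Theses.QuadraticWindow.HostInducedRep := by
  refine hostInducedRep_of_forall_two_le fun n _hn ↦ ?_
  intro F₀ F _ _ _ _ _ τ hTR hdeg hτ hcpt π e k hreg hpol hpar hodd ℓ _ ι hℓ hunr eψ hψunr hψpar hψnti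
  by_cases hF : IsTotallyReal F ∨ IsCMField F
  · exact inducedPackage_of_S27 hS27 F₀ F n hcpt π ℓ ι eψ hF hdeg hreg
  have hF' : ¬ IsTotallyReal F := fun h ↦ hF (Or.inl h)
  have hH : Hyps τ n π e k ℓ eψ :=
    ⟨hTR, hdeg, hτ, hreg, hpol, hpar, hodd, hℓ, hunr, hψunr, hψpar, hψnti⟩
  have asaiSignExistsCont : ∀ (F E : Type) [Field F] [NumberField F] [Field E] [NumberField E]
      [Algebra F E] (c : E ≃ₐ[F] E), Module.finrank F E = 2 → c ≠ 1 →
      ∀ (N : ℕ) (hcpt : isCompact_glFiniteIntegralLevel N E) (P : CuspidalAutomorphicRepData N E hcpt),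
        0 < N → P.1.IsConjSelfDualAE c → ∃ κ : ℤˣ, P.1.HasAsaiSignCont c κ :=
    fun _ _ _ _ _ _ _ _ h2 hc _ _ P hN hP ↦ P.exists_hasAsaiSignCont hMok h2 hc hN hP
  have hpane := stub_paneLaw_cont asaiSignExistsCont hPin (asaiPoleTransfer_cont hMok hGS)
  obtain ⟨m, B, hm, hB, hK, τ', T, ψ₁, hsix, hdict, hcov⟩ :=
    stub_package_inf1 hAI hBC hExt hArchBC hHen exists_hasInfinityType_gl_one asaiSignExistsCont hPin
      hpane F₀ F τ n hcpt π e k ℓ ι eψ hH hF'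
  -- the ℓ-adic representation of each member (FP 9.10 + JS SMO)
  have hr : ∀ D : GoodPrime F₀ m B, ∃ r : FramedGaloisRep (sqrtNegField F₀ D.1) (PadicAlgCl ℓ) (2 * n),
      r.toGaloisRep.IsSemisimple ∧
        ∀ (u : HeightOneSpectrum (𝓞 (sqrtNegField F₀ D.1))) (β : Multiset ℂ),
          ((ℓ : ℕ) : 𝓞 (sqrtNegField F₀ D.1)) ∉ u.asIdeal → (τ' D).1.HasSatakeParamAt u β →
          (ψ₁ D).IsUnramifiedAt u →
            r.IsUnramifiedAt u ∧ r.HasFrobCharpolyAt u (arithFrobPolyOfSatake ι u.residueCard (2 * n)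
              (β.map (fun b ↦ b * ((ψ₁ D).valueAtUniformizer u)⁻¹))) := by
    intro D
    haveI : IsCMField (sqrtNegField F₀ D.1) := GoodPrime.isCMField (Or.inl hTR) D
    obtain ⟨h1, h2, h3, h4, h5, h6⟩ := hsix D
    exact stub_galoisOverK_cont hFP hSMO (2 * n) (sqrtNegField F₀ D.1) (hK D) (τ' D) (T D) (ψ₁ D)
      h1 h2 h3 h4 h5 h6 ℓ ι
  choose r hrss hrloc using hr
  refine stub_patch F₀ F n hcpt π ℓ ι eψ m B hm hB r hrss (fun D ↦ ?_) ?_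
  · filter_upwards [hdict D] with u hu v α c huv hv hg
    obtain ⟨hℓu, hψu, β, hβ, heq⟩ := hu v α c huv hv hg
    obtain ⟨hunr', hchar⟩ := hrloc D u β hℓu hβ hψu
    exact ⟨hunr', heq ▸ hchar⟩
  · intro v α c hv hg
    obtain ⟨D, hsplit, u, huv, hℓu, hψu, β, hβ, heq⟩ := hcov v α c hv hg
    obtain ⟨hunr', hchar⟩ := hrloc D u β hℓu hβ hψu
    exact ⟨D, hsplit, u, huv, hunr', heq ▸ hchar⟩

end Summit.Langlands.Langlands.Theorems

end
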